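import Mathlib
import Summits.Ventures.PercRepro2.LocRows
import Summits.Ventures.PercRepro2.SwRow
import Summits.Ventures.PercRepro2.SwOut
import Summits.Ventures.PercRepro2.SwAllRow
import Summits.Ventures.PercRepro2.SwOutAll
import Summits.Ventures.PercRepro2.SwOutArmFlip
import Summits.Ventures.PercRepro2.SwOutArmThm
import Summits.Ventures.PercRepro2.SwOutCoreDefs
import Summits.Ventures.PercRepro2.SwOutCoreHull
import Summits.Ventures.PercRepro2.SwOutCoreDual

/-!
# The core cube: the clusters of `u` and the canonical base (blind cell PercRepro2, night-4 g13,
2026-08-26; proofs/NIGHT4-G13.md §4 (C2))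

The red cluster of `u` along the core cube (`cluster_coreReal_u`: the red cluster of `h` when a
red h-arm is adjacent to `u`, else `u` with the red pure arms — the sealed dropped arms), the
EXTENDED HULL `hull h ∪ hull u` (constant along the cube: `extHull_coreReal`), its blue part
(`blueExt_coreReal`: the arms assigned `false`), and the CANONICAL BASE
`coreBaseOf ζ = flip ((C_B(h) ∪ C_B(u)) ∖ {h, u}) ζ`, which recovers the base from every cube point
(`coreBaseOf_coreReal`).  Every cube point has `u` in the hull of `h` with the hull of `u` inside
`H` (`u_mem_hull_coreReal`, `hull_u_coreReal_subset`) — the CORE KIND of the partition of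
NIGHT4-G13.md §4.
-/

namespace Summit.Ventures.PercRepro2

namespace LocRows

open Hull

variable {V : Type*} {E : Type*}

open scoped Classical

variable {ends : E → Sym2 V}

variable (ends) in
/-- The extended hull: the hull of `h` with the hull of `u`. -/
def extHull (ζ : Config E) (h u : V) : Set V := hull ends ζ h ∪ hull ends ζ u

variable (ends) in
/-- The blue part of the extended hull, without `h` and `u`. -/
def blueExt (ζ : Config E) (h u : V) : Set V :=
  (cluster ends (blue ζ) h ∪ cluster ends (blue ζ) u) \ {h, u}

variable (ends) in
/-- The canonical core base of a configuration: its blue arms flipped to red. -/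
noncomputable def coreBaseOf (ζ : Config E) (h u : V) : Config E :=
  flip ends (blueExt ends ζ h u) ζ

section Key

variable {ι : Type*} {A : ι → Set V} {pure : ι → Prop} {ζ : Config E} {h u : V} {H : Set V}
  (hb : CoreBase ends ζ h u H A pure)
include hb

/-- The red pure arms with `u`. -/
lemma CoreBase.mem_cluster_u_of_pure {ω : Config ι} {i : ι} (hi : ω i = true) (hpi : pure i)
    {x : V} (hx : x ∈ A i) : x ∈ cluster ends (coreReal ends A ζ ω) u :=
  cluster_mono (hb.insideConfig_le_coreReal hi (Or.inr rfl)) u (hb.pure_conn i hpi x hx)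

/-- **The red cluster of `u`**: the red cluster of `h` when some red h-arm is adjacent to `u`, else
`u` with the red pure arms. -/
theorem CoreBase.cluster_coreReal_u (ω : Config ι) :
    cluster ends (coreReal ends A ζ ω) u =
      if uRed ends A u pure ω then redSet ends A h u pure ω
      else {u} ∪ {x | ∃ i, ω i = true ∧ pure i ∧ x ∈ A i} := by
  by_cases hu : uRed ends A u pure ω
  · rw [if_pos hu, ← hb.cluster_coreReal]
    have huT := hb.u_mem_cluster_of_uRed hu
    ext x
    exact ⟨fun hx => conn_trans huT hx, fun hx => conn_trans (conn_symm huT) hx⟩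
  · rw [if_neg hu]
    apply Set.Subset.antisymm
    · intro v hv
      refine mem_of_conn_of_closed (ends := ends) (ω := coreReal ends A ζ ω)
        (S := {u} ∪ {x | ∃ i, ω i = true ∧ pure i ∧ x ∈ A i}) ?_ (Or.inl rfl) hv
      intro a ha b hab
      obtain ⟨_, e, he, hends⟩ := openGraph_adj.1 hab
      rcases ha with ha | ⟨i, hi, hpi, ha⟩
      · rw [Set.mem_singleton_iff] at ha
        subst ha
        obtain ⟨j, hj, hbj⟩ := hb.red_arm_of_red_at_u hends he
        by_cases hpj : pure j
        · exact Or.inr ⟨j, hj, hpj, hbj⟩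
        · exact absurd ⟨j, hj, hpj, e, b, hends, hbj⟩ hu
      · rcases hb.end_of_red_of_mem_arm hi hends ha he with hbi | hbh | hbu
        · exact Or.inr ⟨i, hi, hpi, hbi⟩
        · exfalso
          subst hbh
          exact hb.pure_no_h i hpi e a (ends_swap hends) ha
        · exact Or.inl hbu
    · rintro v (hv | ⟨i, hi, hpi, hv⟩)
      · rw [Set.mem_singleton_iff] at hv; subst hv; exact mem_cluster_self _ _ _
      · exact hb.mem_cluster_u_of_pure hi hpi hv

/-- The blue cluster of `u` along the cube. -/
theorem CoreBase.cluster_blue_coreReal_u (ω : Config ι) :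
    cluster ends (blue (coreReal ends A ζ ω)) u =
      if uRed ends A u pure (flipAll ω) then redSet ends A h u pure (flipAll ω)
      else {u} ∪ {x | ∃ i, flipAll ω i = true ∧ pure i ∧ x ∈ A i} := by
  rw [hb.blue_coreReal]
  exact hb.dual.cluster_coreReal_u (flipAll ω)

/-- `u` lies in the hull of `h` at every cube point. -/
theorem CoreBase.u_mem_hull_coreReal (ω : Config ι) : u ∈ hull ends (coreReal ends A ζ ω) h := by
  obtain ⟨i, hpi, e, x, hux, hx⟩ := hb.u_hadj
  by_cases hi : ω i = true
  · exact Or.inl (hb.u_mem_cluster_of_uRed ⟨i, hi, hpi, e, x, hux, hx⟩)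
  · right
    rw [hb.cluster_blue_coreReal]
    have hi' : flipAll ω i = true := by simp only [flipAll]; simpa using hi
    exact (hb.dual.cluster_coreReal (flipAll ω)) ▸
      hb.dual.u_mem_cluster_of_uRed ⟨i, hi', hpi, e, x, hux, hx⟩

/-- The hull of `u` lies in `H` at every cube point. -/
theorem CoreBase.hull_u_coreReal_subset (ω : Config ι) :
    hull ends (coreReal ends A ζ ω) u ⊆ H := by
  have key : ∀ (ω' : Config ι),
      (if uRed ends A u pure ω' then redSet ends A h u pure ω'
        else {u} ∪ {x | ∃ i, ω' i = true ∧ pure i ∧ x ∈ A i}) ⊆ H := by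
    intro ω' x hx
    split_ifs at hx with hu
    · exact hb.redSet_subset ω' hx
    · rcases hx with hx | ⟨i, _, _, hx⟩
      · rw [Set.mem_singleton_iff] at hx; subst hx; exact hb.u_mem
      · exact (hb.arm_sub i x hx).1
  intro x hx
  rcases hx with hx | hx
  · rw [hb.cluster_coreReal_u] at hx; exact key ω hx
  · rw [hb.cluster_blue_coreReal_u] at hx; exact key (flipAll ω) hx

/-- **The extended hull is `H` at every cube point.** -/
theorem CoreBase.extHull_coreReal (ω : Config ι) : extHull ends (coreReal ends A ζ ω) h u = H := by
  apply Set.Subset.antisymm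
  · intro x hx
    rcases hx with hx | hx
    · exact hb.hull_coreReal_subset ω hx
    · exact hb.hull_u_coreReal_subset ω hx
  · intro x hxH
    by_cases hxh : x = h
    · subst hxh; exact Or.inl (Or.inl (mem_cluster_self _ _ _))
    by_cases hxu : x = u
    · subst hxu; exact Or.inl (hb.u_mem_hull_coreReal ω)
    obtain ⟨i, hxi⟩ := hb.arm_cover x hxH hxh hxu
    by_cases hi : ω i = true
    · by_cases hpi : pure i
      · exact Or.inr (Or.inl (hb.mem_cluster_u_of_pure hi hpi hxi))
      · exact Or.inl (Or.inl (hb.mem_cluster_of_harm hi hpi hxi))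
    · have hi' : flipAll ω i = true := by simp only [flipAll]; simpa using hi
      by_cases hpi : pure i
      · right; right
        rw [hb.blue_coreReal]
        exact hb.dual.mem_cluster_u_of_pure hi' hpi hxi
      · left; right
        rw [hb.blue_coreReal]
        exact hb.dual.mem_cluster_of_harm hi' hpi hxi

/-- **The blue part of the extended hull is the set of arms assigned `false`.** -/
theorem CoreBase.blueExt_coreReal (ω : Config ι) :
    blueExt ends (coreReal ends A ζ ω) h u = armsFalseC A ω := by
  ext x
  simp only [blueExt, Set.mem_sdiff, Set.mem_union, Set.mem_insert_iff, Set.mem_singleton_iff,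
    not_or]
  rw [hb.cluster_blue_coreReal, hb.cluster_blue_coreReal_u]
  constructor
  · rintro ⟨hx, hxh, hxu⟩
    have key : ∀ (ω' : Config ι), x ∈ redSet ends A h u pure ω' →
        ∃ i, ω' i = true ∧ x ∈ A i := by
      intro ω' hx'
      rw [mem_redSet_iff] at hx'
      rcases hx' with rfl | ⟨i, hi, _, hx'⟩ | ⟨_, rfl | ⟨i, hi, _, hx'⟩⟩
      · exact absurd rfl hxh
      · exact ⟨i, hi, hx'⟩
      · exact absurd rfl hxu
      · exact ⟨i, hi, hx'⟩
    have key2 : ∃ i, flipAll ω i = true ∧ x ∈ A i := by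
      rcases hx with hx | hx
      · exact key _ hx
      · split_ifs at hx with hu
        · exact key _ hx
        · rcases hx with hx | ⟨i, hi, _, hx⟩
          · exact absurd hx hxu
          · exact ⟨i, hi, hx⟩
    obtain ⟨i, hi, hxi⟩ := key2
    refine ⟨i, ?_, hxi⟩
    simp only [flipAll] at hi
    simpa using hi
  · rintro ⟨i, hi, hxi⟩
    have hi' : flipAll ω i = true := by simp only [flipAll]; rw [hi]; rfl
    refine ⟨?_, (hb.arm_sub i x hxi).2.1, (hb.arm_sub i x hxi).2.2⟩
    by_cases hpi : pure i
    · right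
      split_ifs with hu
      · rw [mem_redSet_iff]; exact Or.inr (Or.inr ⟨hu, Or.inr ⟨i, hi', hpi, hxi⟩⟩)
      · exact Or.inr ⟨i, hi', hpi, hxi⟩
    · left
      rw [mem_redSet_iff]; exact Or.inr (Or.inl ⟨i, hi', hpi, hxi⟩)

/-- **The canonical base recovers the base from every cube point.** -/
theorem CoreBase.coreBaseOf_coreReal (ω : Config ι) :
    coreBaseOf ends (coreReal ends A ζ ω) h u = ζ := by
  unfold coreBaseOf
  rw [hb.blueExt_coreReal]
  exact flip_flip _ _

end Key

end LocRows

end Summit.Ventures.PercRepro2
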